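import Summits.BirchSwinnertonDyer.Rank1Residual.Additive.BudgetFromTamagawaWitnessesLayer
import Summits.BirchSwinnertonDyer.Rank1Residual.Additive.ZpTowerSelmerInfty
import HarnessLib

/-!
# The Route-G budget at level `n` WITHOUT the transport binder `hres` (row T-E3g-BUDn-CERT, N3;
# seat p10 GEN 5 — the T-res infrastructure and this draft by n1011-p17 GEN 4, filed by p10 per
# lead R5-55)

HONEST FRAMING (cell `b2b-bsdres`, run/shared/lean/b2b/bsd-rank1-residual/, verbatim in every
file): the goal of the cell is to DELETE the COMBINATION-SHAPED residual classes of the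
Birch–Swinnerton-Dyer formula for ALL analytic-rank `≤ 1` elliptic curves over `ℚ` — "full BSD
formula for every rank `≤ 1` curve in class `C`" assembled STRICTLY from published theorems — so
that the rank-`≤ 1` remainder becomes exactly the CONSTRUCTION-SHAPED classes, which are TYPED
(missing-input `Prop`s), NOT attempted. This is not "finishing BSD". Team n1011 (N10/N11, the
Route-G LOWER budget node of the CONSTRUCTION-SHAPED classes X3♯/X4♯): research route; nothing is
booked by this file; no mark / label moved. THEOREMS ONLY: no definition, no named fact, no
`sorry`.

## What (p10 GEN 4 HANDOFF item N3)

Row T-E3g-BUDn's `budgetLeLambdaAt_layer_of_tamagawaWitnesses` /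
`residualSelmerRankGeAt_layer_of_tamagawaWitnesses` (`Additive/BudgetFromTamagawaWitnessesLayer.lean`)
carry r2's transport lemma T-res as the hypothesis `hres` (a restricted tower `κ'` of `ℚ_n` with an
injective `Sel_{p^∞}(E_{ℚ_n}/ℚ_{n,∞}) →+ Sel_{p^∞}(E/ℚ_∞)`).  Row T-res (n1011-p01 first half,
n1011-p17 second half) made it a theorem — `ZpTower.exists_selmerInfty_restrictTower_injective`
(`Additive/ZpTowerSelmerInfty.lean`: `kerH1Iso` carries the Selmer conditions over `ℚ_n` into those
over `ℚ`, at every place and every embedding) — so `hres` is DISCHARGED here: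
`budgetLeLambdaAt_layer_of_tamagawaWitnesses_of_zpTower`,
`residualSelmerRankGeAt_layer_of_tamagawaWitnesses_of_zpTower`.  The remaining binders are exactly
N2's others: Greenberg Prop. 4.14, Poitou–Tate duality over `ℚ_n`, the local Euler–Poincaré
formula at the places of `ℚ_n`, the witnesses (discharged from census data in
`BudgetFromTamagawaCertificatesLayer` / its sequel); `p` odd, `p ∤ #E(ℚ)_tors`.  (Draft
bc297f32ddcb31fb by n1011-p17 GEN 4, statements verbatim.)

References: R. Greenberg, LNM 1716 (1999) §5 pp. 114–118 [GreenbergLNM1716]; B. Mazur, Invent.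
Math. 18 (1972) §6.
-/


set_option autoImplicit false

noncomputable section

open scoped Classical

open Function Field NumberField IsDedekindDomain WeierstrassCurve
open Literature.NumberTheory.EllipticCurves Literature.NumberTheory.GaloisRepresentations
open Literature.NumberTheory.GaloisRepresentations.DiscreteGaloisModule (unramifiedSubgroup)
open Literature.NumberTheory.GaloisCohomology

namespace Summit.BirchSwinnertonDyer.Rank1Residual.Additive

variable {W : WeierstrassCurve ℚ} [W.IsElliptic] [W.IsGloballyMinimal] {p : ℕ} [hp : Fact p.Prime]

/-- **T-E3g-BUDn at level `n`, transport discharged**: `budgetLeLambdaAt_layer_of_tamagawaWitnesses`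
with `hres` supplied by `ZpTower.exists_selmerInfty_restrictTower_injective` (row T-res).
[cite: GreenbergLNM1716, §5 pp. 114–118] -/
theorem budgetLeLambdaAt_layer_of_tamagawaWitnesses_of_zpTower (hodd : p ≠ 2)
    (h414 : Greenberg1999.prop414_noFiniteSubmodule_of_not_dvd_torsionOrder)
    (htors : ¬ p ∣ W.torsionOrder) (n b : ℕ)
    (hPT : ∀ (κ : ZpExtension ℚ p) [NumberField (κ.layer n)], κ.IsCyclotomic →
      poitouTate_selmerStructure_duality (κ.layer n))
    (hEP : ∀ (κ : ZpExtension ℚ p) [NumberField (κ.layer n)], κ.IsCyclotomic →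
      ∀ w : HeightOneSpectrum (𝓞 (κ.layer n)),
      localEulerPoincareCharacteristic (w.adicCompletion (κ.layer n)))
    (hwitn : ∀ (κ : ZpExtension ℚ p) [NumberField (κ.layer n)], κ.IsCyclotomic →
      ∃ T₀ : Finset (HeightOneSpectrum (𝓞 (κ.layer n))), b ≤ T₀.card ∧
        (∀ w ∈ T₀, ((p : ℕ) : 𝓞 (κ.layer n)) ∉ w.asIdeal) ∧
        ∀ w ∈ T₀, ∃ u ∈ unramifiedSubgroup
            (((W.baseChange (κ.layer n)).torsionGaloisModule (p : ℤ)).restrictField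
              (w.adicCompletion (κ.layer n))) 1,
          u ∉ (W.baseChange (κ.layer n)).kummerLocalConditionAt (p : ℤ)
            (w.adicCompletion (κ.layer n))) :
    BudgetLeLambdaAt p W b :=
  budgetLeLambdaAt_layer_of_tamagawaWitnesses hodd h414 htors n b
    (fun κ _ _ ↦ ZpTower.exists_selmerInfty_restrictTower_injective W κ n) hPT hEP hwitn

/-- **The residual count at level `n`, transport discharged**:
`residualSelmerRankGeAt_layer_of_tamagawaWitnesses` with `hres` supplied by
`ZpTower.exists_selmerInfty_restrictTower_injective`. [cite: GreenbergLNM1716, §5 pp. 114–118] -/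
theorem residualSelmerRankGeAt_layer_of_tamagawaWitnesses_of_zpTower (hodd : p ≠ 2)
    (htors : ¬ p ∣ W.torsionOrder) (n b : ℕ)
    (hfin : ∀ (κ : ZpExtension ℚ p), κ.IsCyclotomic → Finite {s : W.selmerInfty κ // p • s = 0})
    (hPT : ∀ (κ : ZpExtension ℚ p) [NumberField (κ.layer n)], κ.IsCyclotomic →
      poitouTate_selmerStructure_duality (κ.layer n))
    (hEP : ∀ (κ : ZpExtension ℚ p) [NumberField (κ.layer n)], κ.IsCyclotomic →
      ∀ w : HeightOneSpectrum (𝓞 (κ.layer n)),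
      localEulerPoincareCharacteristic (w.adicCompletion (κ.layer n)))
    (hwitn : ∀ (κ : ZpExtension ℚ p) [NumberField (κ.layer n)], κ.IsCyclotomic →
      ∃ T₀ : Finset (HeightOneSpectrum (𝓞 (κ.layer n))), b ≤ T₀.card ∧
        (∀ w ∈ T₀, ((p : ℕ) : 𝓞 (κ.layer n)) ∉ w.asIdeal) ∧
        ∀ w ∈ T₀, ∃ u ∈ unramifiedSubgroup
            (((W.baseChange (κ.layer n)).torsionGaloisModule (p : ℤ)).restrictField
              (w.adicCompletion (κ.layer n))) 1,
          u ∉ (W.baseChange (κ.layer n)).kummerLocalConditionAt (p : ℤ)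
            (w.adicCompletion (κ.layer n))) :
    ResidualSelmerRankGeAt p W b :=
  residualSelmerRankGeAt_layer_of_tamagawaWitnesses hodd htors n b hfin
    (fun κ _ _ ↦ ZpTower.exists_selmerInfty_restrictTower_injective W κ n) hPT hEP hwitn

end Summit.BirchSwinnertonDyer.Rank1Residual.Additive

end
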